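import Summits.CriticalPhenomena.Ising3D.TaylorTableDecidable
import Summits.CriticalPhenomena.Ising3D.TaylorTableRegionCerts
import Summits.CriticalPhenomena.Ising3D.TaylorRegionCertsEJ
import HarnessLib

/-!
# The TABLE layer of a derivative certificate, XIII: `BoxExcluded` from FOUR kernel-decidable Booleans
(cell `pub-ising3x`, seat boot-1 gen 7; gate (g2) — the all-Boolean capstone named by the lead's pre-registered
rule G2-R, RECORD #28/#30: the composition of boot-1 g6's `TaylorTable.boxExcluded_of_taylorTable_dec`
(TaylorTableDecidable) with recog-1 g11's region certificates (TaylorTableRegionCerts, kernel route;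
TaylorRegionCertsEJ, exact `(E, j)` route))

HONEST FRAMING: lottery ticket; floor = tightest certified 3D Ising CFT bounds; no exact-solution
claim without a proof. Island framing: certified exclusion region at stated derivative order and
assumptions; not a determination of the 3D Ising critical exponents beyond that.

After this file a kind-`deriv` box certificate has NO real-analytic side condition left per box: given the
rational table `T : TaylorTable` and region parameters `πE`, `πO`,
`T.check = true → T.checkEncl = true → (T.evenCert πE).check = true → (T.oddCert πO).check = true → BoxExcluded T.box`
(and the same with the exact-route certificates `evenCertEJ` / `oddCertEJ`). Every hypothesis is an equation
`b = true` for a computable Boolean on finite rational data, so each is replayable bit for bit by the engines'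
readers and decidable by `decide +kernel`. What such a certificate ASSERTS is unchanged: `BoxExcluded T.box` in the
sense of `Literature…ConformalBootstrap3D.SigmaEpsilonSystem` (no unitary σ–ε crossing solution with
`(Δσ, Δε)` in the box, under the typed assumptions of that file). SUFFICIENT only (region side: termwise,
λ-averaged kernel / exact-row tests with interval slack). This file is a two-line composition; it is NOT an
instance — no table of a real functional is checked here. Elementary. [folklore]
-/

namespace Summit.CriticalPhenomena.Ising3D

open Literature.MathematicalPhysics.QuantumFieldTheory.ConformalBootstrap3D

namespace TaylorTable

variable (T : TaylorTable)

/-- **G2-R capstone, kernel route**: `BoxExcluded T.box` from the table check, the decidable coefficient-enclosure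
check, and recog-1's even-region / odd-cone certificates of the table — four Booleans, no Prop hypothesis.
[cite: KosPolandSimmonsduffin2014, §3.3 eq. (3.16)] -/
theorem boxExcluded_of_taylorTable_dec_of_certs (h : T.check = true) (he : T.checkEncl = true)
    (πE : EvenRegionParams) (hE : (T.evenCert πE).check = true)
    (πO : OddConeParams) (hO : (T.oddCert πO).check = true) : BoxExcluded T.box :=
  T.boxExcluded_of_taylorTable_dec h he (T.evenRegion_of_evenCert πE hE) (T.oddCone_of_oddCert πO hO)

/-- **G2-R capstone, exact `(E, j)` route**: as `boxExcluded_of_taylorTable_dec_of_certs` with recog-1's exact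
region certificates `evenCertEJ` / `oddCertEJ`. [cite: KosPolandSimmonsduffin2014, §3.3 eq. (3.16)] -/
theorem boxExcluded_of_taylorTable_dec_of_certsEJ (h : T.check = true) (he : T.checkEncl = true)
    (πE : EvenRegionParamsEJ) (hE : (T.evenCertEJ πE).check = true)
    (πO : OddConeParamsEJ) (hO : (T.oddCertEJ πO).check = true) : BoxExcluded T.box :=
  T.boxExcluded_of_taylorTable_dec h he (T.evenRegion_of_evenCertEJ πE hE) (T.oddCone_of_oddCertEJ πO hO)

/-- Mixed routes (kernel-route even region, exact-route odd cone) compose the same way. [folklore] -/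
theorem boxExcluded_of_taylorTable_dec_of_certs_evenK_oddEJ (h : T.check = true) (he : T.checkEncl = true)
    (πE : EvenRegionParams) (hE : (T.evenCert πE).check = true)
    (πO : OddConeParamsEJ) (hO : (T.oddCertEJ πO).check = true) : BoxExcluded T.box :=
  T.boxExcluded_of_taylorTable_dec h he (T.evenRegion_of_evenCert πE hE) (T.oddCone_of_oddCertEJ πO hO)

/-- Mixed routes (exact-route even region, kernel-route odd cone). [folklore] -/
theorem boxExcluded_of_taylorTable_dec_of_certs_evenEJ_oddK (h : T.check = true) (he : T.checkEncl = true)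
    (πE : EvenRegionParamsEJ) (hE : (T.evenCertEJ πE).check = true)
    (πO : OddConeParams) (hO : (T.oddCert πO).check = true) : BoxExcluded T.box :=
  T.boxExcluded_of_taylorTable_dec h he (T.evenRegion_of_evenCertEJ πE hE) (T.oddCone_of_oddCert πO hO)

end TaylorTable

end Summit.CriticalPhenomena.Ising3D
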